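import Mathlib
import Summits.ValiantsHypothesis.ValiantsHypothesis.Theorems.BarrierLeverPartitionMinorsHitByVPHiddenStatesSecondShellTrapped

/-!
# Route BarrierLever — item `PartitionMinorsHitByVP` (stmt-ValiantsHypothesis-19717), line `hidden-states`:
# VANISHING CROSS MINORS, II — one-step images and token counts

Helper file (`--supports stmt-ValiantsHypothesis-19717`; cell valiant-natproofs, 𝒟-side door (c), registered line
`Cruxes/PartitionMinorsHitByVP/Lines/hidden_states.lean` v8; prover seat val-np-p6 gen 17).  Closes NO item; definition-free.
Refinements of `…SecondShellTrapped.det_eq_zero_of_invariant` (memo HOME/val-np-p6/g17/MEMO-valnp6-g17.md §4):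
* ★ `det_eq_zero_of_invariant_images` — the exceptional row `u i₀` need not have the invariant property `P` itself: it suffices that every
  ONE-STEP IMAGE of `u i₀` of size `≤ t` under a nonzero-weight source map has `P` (criteria Z1⁺ / Z2⁺ of the memo);
* ★ `det_eq_zero_of_unfed_count` — TOKEN COUNT behind a backward-closed set `F'` (criterion Z2#): tokens never enter `F'`, so
  `P(S) := |S ∩ F'| ≤ |C' ∩ F'|` is invariant; if the missing ball set `A` has MORE elements in `F'` than `C'`, the minor `D_{B − A + C'}` vanishes
  (Z2 is the case `C' ∩ F' = ∅`);
* `det_eq_zero_of_trapped_images`, `det_eq_zero_of_unfed_images` — the one-step versions of trapped token / unfed target.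

WHAT THIS IS NOT: no tables are chosen here; nothing on crux 14610 or VP ≠ VNP.
-/

set_option linter.dupNamespace false

namespace Summit.ValiantsHypothesis.ValiantsHypothesis.Theorems.BarrierLever.HiddenStates

open Finset

noncomputable section

namespace SecondShell

open PathTable (mono_expand)

variable {ι : Type} [Fintype ι] [DecidableEq ι]

/-- a row all of whose one-step images of size `≤ t` have `P` lies in the span of the `P`-indicators. -/
theorem row_mem_span_of_images (w : ι → ι → ℂ) (P : Finset ι → Prop) [DecidablePred P]
    (t : ℕ) {r : ℕ} (colJ : Fin r → Finset ι) (hcol : ∀ kk, (colJ kk).card ≤ t) (S : Finset ι)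
    (hS : ∀ φ : ι → ι, (∀ a ∈ S, w a (φ a) ≠ 0) → (S.image φ).card ≤ t → P (S.image φ)) :
    (fun kk => ∏ a ∈ S, ∑ q ∈ colJ kk, w a q) ∈
      Submodule.span ℂ (↑((Finset.univ.filter fun R : Finset ι => R.card ≤ t ∧ P R).image
        fun R : Finset ι => fun kk : Fin r => if R ⊆ colJ kk then (1 : ℂ) else 0) : Set (Fin r → ℂ)) := by
  classical
  have hrow : (fun kk => ∏ a ∈ S, ∑ q ∈ colJ kk, w a q) =
      ∑ φ ∈ Fintype.piFinset (fun a => if a ∈ S then (Finset.univ : Finset ι) else {a}),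
        (∏ a ∈ S, w a (φ a)) • (fun kk => if ∀ a ∈ S, φ a ∈ colJ kk then (1 : ℂ) else 0) := by
    funext kk
    rw [mono_expand w S (colJ kk), Finset.sum_apply]
    refine Finset.sum_congr rfl fun φ _ => ?_
    simp only [Pi.smul_apply, smul_eq_mul]
  rw [hrow]
  refine Submodule.sum_mem _ fun φ _ => ?_
  by_cases hwt : ∏ a ∈ S, w a (φ a) = 0
  · rw [hwt, zero_smul]; exact Submodule.zero_mem _
  refine Submodule.smul_mem _ _ ?_
  have hwt' : ∀ a ∈ S, w a (φ a) ≠ 0 := fun a ha h0 => hwt (Finset.prod_eq_zero ha h0)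
  by_cases hcard : (S.image φ).card ≤ t
  · apply Submodule.subset_span
    rw [Finset.coe_image]
    refine ⟨S.image φ, ?_, ?_⟩
    · rw [Finset.coe_filter]
      exact ⟨Finset.mem_univ _, hcard, hS φ hwt' hcard⟩
    · funext kk
      simp only [Finset.image_subset_iff]
  · have h0 : (fun kk => if ∀ a ∈ S, φ a ∈ colJ kk then (1 : ℂ) else 0) = 0 := by
      funext kk
      rw [Pi.zero_apply, if_neg]
      intro hall
      apply hcard
      calc (S.image φ).card ≤ (colJ kk).card := Finset.card_le_card (Finset.image_subset_iff.2 hall)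
        _ ≤ t := hcol kk
    rw [h0]; exact Submodule.zero_mem _

/-- ★ **Singularity from an invariant property, one-step form.**  `P` invariant under nonzero-weight source maps; columns are points of size
`≤ t`; every one-step image of size `≤ t` of the exceptional row `u i₀` has `P`; every set of size `≤ t` with `P` occurs among the other rows.
Then the monomial matrix is singular. -/
theorem det_eq_zero_of_invariant_images (w : ι → ι → ℂ) (P : Finset ι → Prop) [DecidablePred P]
    (hP : ∀ (S : Finset ι) (φ : ι → ι), (∀ a ∈ S, w a (φ a) ≠ 0) → P S → P (S.image φ))
    (t : ℕ) {r : ℕ} (u colJ : Fin r → Finset ι) (hcol : ∀ kk, (colJ kk).card ≤ t) (i₀ : Fin r)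
    (hi₀ : ∀ φ : ι → ι, (∀ a ∈ u i₀, w a (φ a) ≠ 0) → ((u i₀).image φ).card ≤ t → P ((u i₀).image φ))
    (hall : ∀ R : Finset ι, R.card ≤ t → P R → ∃ i, i ≠ i₀ ∧ u i = R) :
    (Matrix.of fun i kk : Fin r => ∏ a ∈ u i, ∑ q ∈ colJ kk, w a q).det = 0 := by
  classical
  set M : Matrix (Fin r) (Fin r) ℂ := Matrix.of fun i kk : Fin r => ∏ a ∈ u i, ∑ q ∈ colJ kk, w a q with hM
  set Rs : Finset (Finset ι) := Finset.univ.filter fun R : Finset ι => R.card ≤ t ∧ P R with hRs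
  set gs : Finset (Fin r → ℂ) := Rs.image fun R : Finset ι => fun kk : Fin r => if R ⊆ colJ kk then (1 : ℂ) else 0
    with hgs
  set V : Submodule ℂ (Fin r → ℂ) := Submodule.span ℂ (↑gs : Set (Fin r → ℂ)) with hV
  set I : Finset (Fin r) := insert i₀ (Finset.univ.filter fun i : Fin r => P (u i)) with hI
  have hMi : ∀ i, M i = fun kk => ∏ a ∈ u i, ∑ q ∈ colJ kk, w a q := fun i => by funext kk; rw [hM, Matrix.of_apply]
  have hmem : ∀ i ∈ I, M i ∈ V := by
    intro i hi
    rw [hMi]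
    rcases Finset.mem_insert.1 hi with rfl | hi
    · exact row_mem_span_of_images w P t colJ hcol (u i) hi₀
    · exact row_mem_span_of_invariant w P hP t colJ hcol (u i) (Finset.mem_filter.1 hi).2
  have hdim : Module.finrank ℂ V ≤ Rs.card :=
    (finrank_span_finset_le_card gs).trans Finset.card_image_le
  have hi₀I : i₀ ∈ I := Finset.mem_insert_self _ _
  have hcardI : Rs.card + 1 ≤ I.card := by
    haveI : Nonempty (Fin r) := ⟨i₀⟩
    choose! f hf using hall
    have h1 : Rs.card ≤ (I.erase i₀).card := by
      refine Finset.card_le_card_of_injOn f ?_ ?_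
      · intro R hR
        have hR' := (Finset.mem_filter.1 (Finset.mem_coe.1 hR)).2
        obtain ⟨hne, huR⟩ := hf R hR'.1 hR'.2
        rw [Finset.coe_erase, Set.mem_sdiff, Set.mem_singleton_iff, Finset.mem_coe]
        refine ⟨Finset.mem_insert_of_mem (Finset.mem_filter.2 ⟨Finset.mem_univ _, ?_⟩), hne⟩
        rw [huR]; exact hR'.2
      · intro R hR R' hR' hff
        have h1 := (hf R (Finset.mem_filter.1 (Finset.mem_coe.1 hR)).2.1 (Finset.mem_filter.1 (Finset.mem_coe.1 hR)).2.2).2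
        have h2 := (hf R' (Finset.mem_filter.1 (Finset.mem_coe.1 hR')).2.1 (Finset.mem_filter.1 (Finset.mem_coe.1 hR')).2.2).2
        rw [← h1, ← h2, hff]
    have h2 := Finset.card_erase_add_one hi₀I
    omega
  have hdep : ¬ LinearIndependent ℂ (fun i : I => M i) := by
    intro hli
    rw [linearIndependent_iff_card_le_finrank_span, Fintype.card_coe] at hli
    have hle : Set.finrank ℂ (Set.range fun i : I => M i) ≤ Module.finrank ℂ V := by
      apply Submodule.finrank_mono
      rw [Submodule.span_le]
      rintro _ ⟨i, rfl⟩
      exact hmem i i.2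
    omega
  by_contra hdet
  have hU : IsUnit M := (Matrix.isUnit_iff_isUnit_det M).2 (isUnit_iff_ne_zero.2 hdet)
  have hrows : LinearIndependent ℂ M.row := Matrix.linearIndependent_rows_iff_isUnit.2 hU
  exact hdep (hrows.comp (fun i : I => (i : Fin r)) Subtype.val_injective)

/-- ★ **TOKEN COUNT (Z2#).**  `F'` backward-closed; the exceptional row `C' = u i₀` has `c` elements in `F'`; every set of size `≤ t` with at
most `c` elements in `F'` is one of the other rows (so the missing ball set has more than `c`).  Then the monomial matrix is singular. -/
theorem det_eq_zero_of_unfed_count (w : ι → ι → ℂ) (F' : Finset ι) (hF' : ∀ a, ∀ q ∈ F', w a q ≠ 0 → a ∈ F')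
    (t : ℕ) {r : ℕ} (u colJ : Fin r → Finset ι) (hcol : ∀ kk, (colJ kk).card ≤ t) (i₀ : Fin r)
    (hall : ∀ R : Finset ι, R.card ≤ t → (R ∩ F').card ≤ (u i₀ ∩ F').card → ∃ i, i ≠ i₀ ∧ u i = R) :
    (Matrix.of fun i kk : Fin r => ∏ a ∈ u i, ∑ q ∈ colJ kk, w a q).det = 0 := by
  classical
  refine det_eq_zero_of_invariant w (fun S => (S ∩ F').card ≤ (u i₀ ∩ F').card) ?_ t u colJ hcol i₀ le_rfl hall
  intro S φ hwt hS
  refine le_trans (Finset.card_le_card ?_) ((Finset.card_image_le (f := φ) (s := S ∩ F')).trans hS)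
  intro x hx
  rw [Finset.mem_inter] at hx
  obtain ⟨a, ha, rfl⟩ := Finset.mem_image.1 hx.1
  exact Finset.mem_image.2 ⟨a, Finset.mem_inter.2 ⟨ha, hF' a (φ a) hx.2 (hwt a ha)⟩, rfl⟩

/-- **TRAPPED TOKEN, one-step form (Z1⁺).**  `F` forward-closed; every one-step image of size `≤ t` of the exceptional row meets `F`; every set of
size `≤ t` meeting `F` is one of the other rows. -/
theorem det_eq_zero_of_trapped_images (w : ι → ι → ℂ) (F : Finset ι) (hF : ∀ a ∈ F, ∀ q, w a q ≠ 0 → q ∈ F)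
    (t : ℕ) {r : ℕ} (u colJ : Fin r → Finset ι) (hcol : ∀ kk, (colJ kk).card ≤ t) (i₀ : Fin r)
    (hi₀ : ∀ φ : ι → ι, (∀ a ∈ u i₀, w a (φ a) ≠ 0) → ((u i₀).image φ).card ≤ t → ((u i₀).image φ ∩ F).Nonempty)
    (hall : ∀ R : Finset ι, R.card ≤ t → (R ∩ F).Nonempty → ∃ i, i ≠ i₀ ∧ u i = R) :
    (Matrix.of fun i kk : Fin r => ∏ a ∈ u i, ∑ q ∈ colJ kk, w a q).det = 0 := by
  classical
  refine det_eq_zero_of_invariant_images w (fun S => (S ∩ F).Nonempty) ?_ t u colJ hcol i₀ hi₀ hall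
  intro S φ hwt hS
  obtain ⟨a, ha⟩ := hS
  rw [Finset.mem_inter] at ha
  exact ⟨φ a, Finset.mem_inter.2 ⟨Finset.mem_image_of_mem φ ha.1, hF a ha.2 (φ a) (hwt a ha.1)⟩⟩

/-- **UNFED TARGET, one-step form (Z2⁺).**  `F'` backward-closed; every one-step image of size `≤ t` of the exceptional row avoids `F'`; every set
of size `≤ t` avoiding `F'` is one of the other rows. -/
theorem det_eq_zero_of_unfed_images (w : ι → ι → ℂ) (F' : Finset ι) (hF' : ∀ a, ∀ q ∈ F', w a q ≠ 0 → a ∈ F')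
    (t : ℕ) {r : ℕ} (u colJ : Fin r → Finset ι) (hcol : ∀ kk, (colJ kk).card ≤ t) (i₀ : Fin r)
    (hi₀ : ∀ φ : ι → ι, (∀ a ∈ u i₀, w a (φ a) ≠ 0) → ((u i₀).image φ).card ≤ t → Disjoint ((u i₀).image φ) F')
    (hall : ∀ R : Finset ι, R.card ≤ t → Disjoint R F' → ∃ i, i ≠ i₀ ∧ u i = R) :
    (Matrix.of fun i kk : Fin r => ∏ a ∈ u i, ∑ q ∈ colJ kk, w a q).det = 0 := by
  classical
  refine det_eq_zero_of_invariant_images w (fun S => Disjoint S F') ?_ t u colJ hcol i₀ hi₀ hall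
  intro S φ hwt hS
  rw [Finset.disjoint_left]
  intro x hx hxF
  obtain ⟨a, ha, rfl⟩ := Finset.mem_image.1 hx
  exact Finset.disjoint_left.1 hS ha (hF' a (φ a) hxF (hwt a ha))

end SecondShell

end

end Summit.ValiantsHypothesis.ValiantsHypothesis.Theorems.BarrierLever.HiddenStates
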